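import Summits.QuantumFields.YangMills.Theorems.UnitScaleTiltProp7CombFrameLinearResponseStepT3
import Summits.QuantumFields.YangMills.Theorems.UnitScaleTiltProp7CombTreeRatioLinearResponse
import Summits.QuantumFields.YangMills.Theorems.UnitScaleTiltProp7FrameResponseCombSU2T3
import HarnessLib

/-!
# Route `UnitScaleTilt`, crux K1 «MinimiserStabilityRegPr» (stmt-QuantumFields-19200), route-R E′ (A′)-on-Σ, P-A2-COMB (β), item «R0-RECURSION» (★★OWNER RULINGS №19∕№20), REM2ᶜ ⟸ `hMcomb₂`
# (★px17 g4's F-αᶜ∕F-βᶜ∕F-γᶜ), sub-brick R0-LIN-C FILE 2ᶜ — THE DIFFERENTIABILITY ROWS `hT`∕`hF` OF ✓`Prop7CombFrameLinearResponseStep` DISCHARGED AT A PRINTED-REGULAR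
# BACKGROUND, EVERY LEVEL `j ≤ K − n`: PRINT's single-bar comb tower `A ↦ Ũ₁ʲ[(e^{A})♯](z, κ)` and its accumulated frames `A ↦ v_j[(e^{A})♯](z)` are ANALYTIC at `A = 0`
# ([Balaban1985Averaging] Prop. 4 ∕ Prop. 6 at the pulled-back `SU(2)` background, lit ✓`B7Prop6GeneralAnalytic`); hence the comb derivative recursion holds at the member with NO displayed
# hypothesis, its tree-ratio summand read as `tsum` (✓`Prop7CombTreeRatioLinearResponse`) — ★px17 F-γᶜ2's row `hℓ` inhabited by `ℓ := fderiv … 0 A`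

Cell `ym3-torus`, twin-width seat `ym-routeR-w2` (gen 9); ★px17 g4 06:42:23Z «routeR-w2: 2ᶜ ∕ 3ᶜ GO — BOTH».  THE COMB TWIN of ✓`Prop7SymFrameLinearResponseOfRegPr` (R0-LIN-S FILE 2).
THEOREMS ONLY (0 `def`, 0 `sorry`); `--supports stmt-QuantumFields-19200 --as helper`, count-neutral.  YM₃ on T³ is a ladder rung (R3), not the Clay problem; nothing here claims the
stub, the crux, (β), `hPA2`, `hcoS`, d = 4 or the mass gap.

THE POINT.  ✓R0-LIN-C (`Prop7CombFrameLinearResponseStep.fderiv_coe_vcov_succ_apply`) displays per level `hT` (the single-bar tower's level-`j` bonds `t ↦ ↑(tildIter L U₀ (U₁ t) j x κ)`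
differentiable at the base) and `hF` (the level-`j` comb frames).  At the member — background `W` with `RegPr F n K ε₀ W`, the comb window `10⁷L³ε₀ ≤ 1` of ✓`Prop7FrameResponseCombSU2.windows_of_ten7`,
pulled-back letters `U₀♯ = pull (bgUnits W) x₀`, `(e^{A})♯ = pull (e^{A}) x₀`, `x₀ = basePt F n K` — both hold at `A = 0` for EVERY `j ≤ K − n` and EVERY `z ∈ ℤ³`, by lit-balaban's
Proposition 4∕6 analyticity at a general background (✓`B7Prop6GeneralAnalytic.analyticAt_vcovQ`, ✓`prop6_general_analyticAt` ∘ ✓`avgIter_eq_avgQG`, the frames' identification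
✓`vcov_eq_vcovQ` on the (131)-window ✓`Prop7SymAvgTwFrameDiff.eventually_window`), exactly as ✓`Prop7SymAvgTwFrameDiff.analyticAt_frameTw_zero_of_regPr` reads the TOP level; the
level-`j` (52)-input is the top one by monotonicity (`α₀(Lʲ)⁻² ≥ α₀(L^{K−n})⁻²`).
* §1 `pdev_window_of_le` (level monotonicity of (52)), `tower_data_of_regPr` (the pulled-back background: `SU(2)`-valued, (52) at every `j ≤ K − n`, windows).
* §2 ★★ `analyticAt_coe_vcov_of_regPr` ∕ `differentiableAt_coe_vcov_of_regPr` (= `hF`), ★★ `analyticAt_coe_avgIter_mul_of_regPr`, ★★ `analyticAt_coe_tildIter_of_regPr` ∕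
  `differentiableAt_coe_tildIter_of_regPr` (= `hT`), every `j ≤ K − n`, every `z`, `κ`.
* §3 ★★★ `fderiv_vcov_succ_apply_of_regPr` — ✓R0-LIN-C's applied comb recursion at the member, HYPOTHESIS-FREE (`j + 1 ≤ K − n`); `fderiv_wframe_succ_apply_of_regPr` (one-step comb frame).
* §4 ★★★ `fderiv_combTreeRatio_apply_of_regPr` (✓FILE 3ᶜ `fderiv_combTreeRatio_apply` with `hT` discharged) and ★★★ `fderiv_vcov_succ_apply_tsum_of_regPr` — ★px17 F-γᶜ2's `hℓ` right side with
  `ℓ l := fderiv ℂ (A ↦ ↑(v_l[(e^{A})♯](·))) 0 A`, `ℓY l x κ := fderiv ℂ (A ↦ ↑(Ũ₁ˡ[(e^{A})♯](x, κ))) 0 A` TOKEN FOR TOKEN (`covTsum` = lit `B7Prop3GeneralRotated.tsum`).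
HONEST SCOPE.  Window arithmetic + lit-balaban's landed analyticity rows; no estimate beyond differentiability, no currency; nothing of print asserted beyond what lit certifies; REM2ᶜ,
`hMcomb₂`, (β), `hD`, `hPA2`, `hcoS`, the stub and the crux are NOT advanced analytically by this file.

References: T. Bałaban, CMP 98 (1985) 17–51 [Balaban1985Averaging] ((52) p.26, (58) p.27, (69) p.29, (97) p.32, (127) p.37, (131) Prop. 4 p.38, (159)–(163) p.42, Prop. 6 p.43);
CMP 99 (1985) 75–102 [Balaban1985RegularSpaces] ((1.139) p.100).
-/

set_option autoImplicit false

noncomputable section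

open scoped Matrix.Norms.L2Operator BigOperators Topology

namespace Summit.QuantumFields.YangMills.Theorems.Prop7CombFrameLinearResponseOfRegPr

open NormedSpace Metric Set Filter
open Literature.MathematicalPhysics.QuantumFieldTheory.Balaban1983to89
open Literature.MathematicalPhysics.QuantumFieldTheory.Balaban1983to89.T3ContinuumYM3Torus
open T3PrintedRegularMinimiser (RegPr)
open T3SectALandauChart (bgUnits)
open B7Prop1Explicit renaming Site → LSite
open B7Prop1Explicit (expUnit val_expUnit hol treeWord boxVec Letter)
open B7Prop2Explicit (avgIter pdev C0 c2' AvgClosed)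
open B7Prop2SpecialUnitary (specialUnitaryUnits)
open B7Prop3Flat (expCfg c3 c3_nonneg)
open B7Eq92Concrete (vcov tildIter tildIter_apply wframe dbavgCovIter)
open B7Prop3GeneralRotated (tsum)
open B7Eq123General (dbavgCovIter_eq_expCfg_logCovIter)
open B7Prop6GeneralAnalytic (vcovQ vcov_eq_vcovQ analyticAt_vcovQ avgQG avgIter_eq_avgQG prop6_general_analyticAt)
open B7AvgClosedSpecialUnitarySharp (avgClosed_specialUnitary_of_le_twentyone)
open B10Eq27TorusAxialLog (pull pull_apply transl unitsField toUField)
open Summit.QuantumFields.YangMills.Theorems.Prop7SPrint (basePt)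
open Summit.QuantumFields.YangMills.Theorems.Prop7AxialReprPrint (pull_toUField_mem inAk_pull_of_regPr pdev_pull_lt)
open Summit.QuantumFields.YangMills.Theorems.Prop7SymAvgGLSmallOfRegPr (bgUnits_eq)
open Summit.QuantumFields.YangMills.Theorems.Prop7SymAvgTwFrameDiff (pull_expUnit_eq_expCfg norm_pullExp_le eventually_window)
open Summit.QuantumFields.YangMills.Theorems.Prop7FrameResponseCombSU2 (windows_of_ten7)
open Summit.QuantumFields.YangMills.Theorems.Prop7CombFrameLinearResponseStep (fderiv_coe_vcov_succ_apply fderiv_coe_wframe_succ_apply comb_family_zero)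
open Summit.QuantumFields.YangMills.Theorems.Prop7CombTreeRatioLinearResponse (fderiv_combTreeRatio_apply)

variable (F : T3Family) {n K : ℕ}

/-! ## §1 The pulled-back background: level data from `RegPr` -/

/-- **(52) IS MONOTONE IN THE LEVEL**: `pdev U₀ < α₀·(L^{k})⁻²` and `j ≤ k` give `pdev U₀ < α₀·(L^{j})⁻²` (`1 ≤ L`). [cite: Balaban1985Averaging, (52) p.26] -/
theorem pdev_window_of_le {d : ℕ} {𝔸 : Type*} [NormedRing 𝔸] [NormedAlgebra ℂ 𝔸] [CompleteSpace 𝔸] {L : ℕ} (hL : 1 ≤ L) {U₀ : LSite d → Fin d → 𝔸ˣ} {α₀ : ℝ} (hα : 0 ≤ α₀)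
    {j k : ℕ} (hjk : j ≤ k) (h52 : pdev U₀ < α₀ * ((((L : ℝ) ^ k)⁻¹) ^ 2)) : pdev U₀ < α₀ * ((((L : ℝ) ^ j)⁻¹) ^ 2) := by
  refine lt_of_lt_of_le h52 (mul_le_mul_of_nonneg_left ?_ hα)
  have hL1 : (1 : ℝ) ≤ L := by exact_mod_cast hL
  have hpow : (L : ℝ) ^ j ≤ (L : ℝ) ^ k := pow_le_pow_right₀ hL1 hjk
  have hj0 : 0 < (L : ℝ) ^ j := by positivity
  have hinv : ((L : ℝ) ^ k)⁻¹ ≤ ((L : ℝ) ^ j)⁻¹ := inv_anti₀ hj0 hpow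
  exact pow_le_pow_left₀ (by positivity) hinv 2

variable {F}

/-- **THE PULLED-BACK BACKGROUND OF A PRINTED-REGULAR `W`**: `U₀♯ = pull (bgUnits W) x₀` is `SU(2)`-valued and satisfies (52) with `α₀ = 2ε₀` at EVERY level `j ≤ K − n`
(✓`Prop7AxialReprPrint.pdev_pull_lt ∘ inAk_pull_of_regPr` at the top + `pdev_window_of_le`). [cite: Balaban1985Averaging, (52) p.26; Balaban1985RegularSpaces, (1.139) p.100] -/
theorem tower_data_of_regPr {ε₀ : ℝ} (hε₀ : 0 < ε₀) (W : GaugeField (F.P K) 0 (Matrix.specialUnitaryGroup (Fin 2) ℂ)) (hreg : RegPr F n K ε₀ W) {j : ℕ} (hj : j ≤ K - n) :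
    (∀ z κ, pull (bgUnits F K W) (basePt F n K) z κ ∈ specialUnitaryUnits (Fin 2)) ∧
    pdev (pull (bgUnits F K W) (basePt F n K)) < 2 * ε₀ * (((((F.P K).L : ℝ) ^ j)⁻¹) ^ 2) := by
  refine ⟨fun z κ => by rw [bgUnits_eq]; exact pull_toUField_mem W _ z κ, ?_⟩
  have h52 : pdev (pull (bgUnits F K W) (basePt F n K)) < 2 * ε₀ * (((((F.P K).L : ℝ) ^ (K - n))⁻¹) ^ 2) := by
    rw [bgUnits_eq]; exact pdev_pull_lt (P := F.P K) hε₀ (inAk_pull_of_regPr F (n := n) (K := K) hε₀.le hreg) (basePt F n K)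
  exact pdev_window_of_le (le_trans (by norm_num) (F.P K).hL.2) (by positivity) hj h52

/-! ## §2 ★★ The comb frames and the single-bar tower are analytic at `A = 0`, every level -/

/-- ★★ **`hF` DISCHARGED — PRINT's COMB ACCUMULATED FRAME `A ↦ v_j[(e^{A})♯](z)` IS ANALYTIC AT `A = 0`** for every `j ≤ K − n` and every `z ∈ ℤ³`, at a printed-regular background with
`10⁷L³ε₀ ≤ 1` (lit ✓`analyticAt_vcovQ` at level `K − n`, index `j`, with ✓`vcov_eq_vcovQ` on the window ✓`eventually_window`; the proof of ✓`analyticAt_frameTw_zero_of_regPr` at `(j, z)`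
in place of `(K − n, coordT3 y)`). [cite: Balaban1985Averaging, Prop. 4 p.38, (97) p.32, (160)–(163) p.42] -/
theorem analyticAt_coe_vcov_of_regPr {ε₀ : ℝ} (hε₀ : 0 < ε₀) (hε : 10 ^ 7 * (F.L : ℝ) ^ 3 * ε₀ ≤ 1)
    (W : GaugeField (F.P K) 0 (Matrix.specialUnitaryGroup (Fin 2) ℂ)) (hreg : RegPr F n K ε₀ W) {j : ℕ} (hj : j ≤ K - n) (z : LSite (F.P K).d) :
    AnalyticAt ℂ (fun A : PBond (F.P K) 0 → Matrix (Fin 2) (Fin 2) ℂ =>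
      ((vcov (F.P K).L (pull (bgUnits F K W) (basePt F n K)) (pull (fun b => expUnit (A b)) (basePt F n K)) j z : (Matrix (Fin 2) (Fin 2) ℂ)ˣ) : Matrix (Fin 2) (Fin 2) ℂ)) 0 := by
  obtain ⟨hα3, hα4, hexp, -, -⟩ := windows_of_ten7 F (K := K) hε₀.le hε
  have hL2 : 2 ≤ (F.P K).L := (F.P K).hL.2
  have hL1 : 1 ≤ (F.P K).L := le_trans (by norm_num) hL2
  have hd : (F.P K).d = 3 := T3Family.P_d F K
  obtain ⟨hU₀, -⟩ := tower_data_of_regPr hε₀ W hreg hj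
  have h52 := (tower_data_of_regPr hε₀ W hreg le_rfl).2
  have hG := avgClosed_specialUnitary_of_le_twentyone (N := 2) (by norm_num) (F.P K).d (F.P K).L
  have hα : 0 < 2 * ε₀ := by positivity
  set B : (PBond (F.P K) 0 → Matrix (Fin 2) (Fin 2) ℂ) → LSite (F.P K).d → Fin (F.P K).d → Matrix (Fin 2) (Fin 2) ℂ :=
    fun A z κ => A ⟨transl (basePt F n K) z, κ⟩ with hB
  have hBa : ∀ z κ, AnalyticAt ℂ (fun A : PBond (F.P K) 0 → Matrix (Fin 2) (Fin 2) ℂ => B A z κ) 0 := fun z κ =>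
    (ContinuousLinearMap.proj (R := ℂ) (φ := fun _ : PBond (F.P K) 0 => Matrix (Fin 2) (Fin 2) ℂ) (⟨transl (basePt F n K) z, κ⟩ : PBond (F.P K) 0)).analyticAt 0
  have hB0 : ∀ z κ, ‖B 0 z κ‖ ≤ 0 := fun z κ => by rw [hB]; simp
  have hsmall0 : Real.exp (4 * (800 * (((F.P K).d : ℝ) + 1) ^ 2 * (((F.P K).d : ℝ) + 4)) * (2 * ε₀))
      * (1 + 8 * (131072 * (((F.P K).d : ℝ) + 1) ^ 2) * (((F.P K).L : ℝ) ^ (K - n) * 0)) ≤ 2 := by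
    rw [mul_zero, mul_zero, add_zero, mul_one]; exact hexp.le
  have hc₃0 : 2 * ((((F.P K).L : ℝ)) ^ (K - n) * 0) ≤ c3 (F.P K).d (F.P K).L := by
    rw [mul_zero, mul_zero]; exact c3_nonneg _ _
  have κ₀ : Fin (F.P K).d := Fin.cast hd.symm 0
  have hvQ := (analyticAt_vcovQ (E := PBond (F.P K) 0 → Matrix (Fin 2) (Fin 2) ℂ) (F.P K).L hL2 hG (K - n) (pull (bgUnits F K W) (basePt F n K)) hU₀ hα hα3 hα4 h52 B hBa
    le_rfl hB0 hsmall0 hc₃0 κ₀ j hj z).1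
  have hev : (fun A : PBond (F.P K) 0 → Matrix (Fin 2) (Fin 2) ℂ =>
        ((vcovQ (F.P K).L (pull (bgUnits F K W) (basePt F n K)) (B A) j z : (Matrix (Fin 2) (Fin 2) ℂ)ˣ) : Matrix (Fin 2) (Fin 2) ℂ))
      =ᶠ[𝓝 0] fun A => ((vcov (F.P K).L (pull (bgUnits F K W) (basePt F n K)) (pull (fun b => expUnit (A b)) (basePt F n K)) j z : (Matrix (Fin 2) (Fin 2) ℂ)ˣ) :
        Matrix (Fin 2) (Fin 2) ℂ) := by
    filter_upwards [eventually_window F (d := (F.P K).d) (L := (F.P K).L) (k := K - n) hL1 hexp] with A hA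
    have hQ := dbavgCovIter_eq_expCfg_logCovIter (F.P K).L hL2 hG (K - n) (pull (bgUnits F K W) (basePt F n K)) hU₀ hα hα3 hα4 h52 (B A)
      (norm_nonneg A) (fun z κ => norm_pullExp_le F A (basePt F n K) z κ) hA.1 hA.2
    rw [pull_expUnit_eq_expCfg, vcov_eq_vcovQ (F.P K).L _ (B A) (K - n) hQ j hj]
  exact hvQ.congr hev

/-- `hF` in `DifferentiableAt` currency (the row of ✓`Prop7CombFrameLinearResponseStep.fderiv_coe_vcov_succ_apply`). [cite: Balaban1985Averaging, (97) p.32, Prop. 4 p.38] -/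
theorem differentiableAt_coe_vcov_of_regPr {ε₀ : ℝ} (hε₀ : 0 < ε₀) (hε : 10 ^ 7 * (F.L : ℝ) ^ 3 * ε₀ ≤ 1)
    (W : GaugeField (F.P K) 0 (Matrix.specialUnitaryGroup (Fin 2) ℂ)) (hreg : RegPr F n K ε₀ W) {j : ℕ} (hj : j ≤ K - n) (z : LSite (F.P K).d) :
    DifferentiableAt ℂ (fun A : PBond (F.P K) 0 → Matrix (Fin 2) (Fin 2) ℂ =>
      ((vcov (F.P K).L (pull (bgUnits F K W) (basePt F n K)) (pull (fun b => expUnit (A b)) (basePt F n K)) j z : (Matrix (Fin 2) (Fin 2) ℂ)ˣ) : Matrix (Fin 2) (Fin 2) ℂ)) 0 :=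
  (analyticAt_coe_vcov_of_regPr hε₀ hε W hreg hj z).differentiableAt

/-- ★★ **THE FULL COMB AVERAGE `A ↦ \overline{(e^{A})♯U₀♯}ʲ(z, κ)` IS ANALYTIC AT `A = 0`** for every `j ≤ K − n` (lit ✓`prop6_general_analyticAt` ∘ ✓`avgIter_eq_avgQG` at level `j`, (52) at
level `j` by §1, window ✓`eventually_window` at level `j`). [cite: Balaban1985Averaging, Proposition 6 p.43, (159) p.42, Prop. 4 p.38] -/
theorem analyticAt_coe_avgIter_mul_of_regPr {ε₀ : ℝ} (hε₀ : 0 < ε₀) (hε : 10 ^ 7 * (F.L : ℝ) ^ 3 * ε₀ ≤ 1)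
    (W : GaugeField (F.P K) 0 (Matrix.specialUnitaryGroup (Fin 2) ℂ)) (hreg : RegPr F n K ε₀ W) {j : ℕ} (hj : j ≤ K - n) (z : LSite (F.P K).d) (κ : Fin (F.P K).d) :
    AnalyticAt ℂ (fun A : PBond (F.P K) 0 → Matrix (Fin 2) (Fin 2) ℂ =>
      ((avgIter (F.P K).L (pull (fun b => expUnit (A b)) (basePt F n K) * pull (bgUnits F K W) (basePt F n K)) j z κ : (Matrix (Fin 2) (Fin 2) ℂ)ˣ) :
        Matrix (Fin 2) (Fin 2) ℂ)) 0 := by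
  obtain ⟨hα3, hα4, hexp, -, -⟩ := windows_of_ten7 F (K := K) hε₀.le hε
  have hL2 : 2 ≤ (F.P K).L := (F.P K).hL.2
  have hL1 : 1 ≤ (F.P K).L := le_trans (by norm_num) hL2
  obtain ⟨hU₀, h52j⟩ := tower_data_of_regPr hε₀ W hreg hj
  have hG := avgClosed_specialUnitary_of_le_twentyone (N := 2) (by norm_num) (F.P K).d (F.P K).L
  have hα : 0 < 2 * ε₀ := by positivity
  set B : (PBond (F.P K) 0 → Matrix (Fin 2) (Fin 2) ℂ) → LSite (F.P K).d → Fin (F.P K).d → Matrix (Fin 2) (Fin 2) ℂ :=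
    fun A z κ => A ⟨transl (basePt F n K) z, κ⟩ with hB
  have hBa : ∀ z κ, AnalyticAt ℂ (fun A : PBond (F.P K) 0 → Matrix (Fin 2) (Fin 2) ℂ => B A z κ) 0 := fun z κ =>
    (ContinuousLinearMap.proj (R := ℂ) (φ := fun _ : PBond (F.P K) 0 => Matrix (Fin 2) (Fin 2) ℂ) (⟨transl (basePt F n K) z, κ⟩ : PBond (F.P K) 0)).analyticAt 0
  have hB0 : ∀ z κ, ‖B 0 z κ‖ ≤ 0 := fun z κ => by rw [hB]; simp
  have hsmall0 : Real.exp (4 * (800 * (((F.P K).d : ℝ) + 1) ^ 2 * (((F.P K).d : ℝ) + 4)) * (2 * ε₀))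
      * (1 + 8 * (131072 * (((F.P K).d : ℝ) + 1) ^ 2) * (((F.P K).L : ℝ) ^ j * 0)) ≤ 2 := by
    rw [mul_zero, mul_zero, add_zero, mul_one]; exact hexp.le
  have hc₃0 : 2 * ((((F.P K).L : ℝ)) ^ j * 0) ≤ c3 (F.P K).d (F.P K).L := by
    rw [mul_zero, mul_zero]; exact c3_nonneg _ _
  have han := prop6_general_analyticAt (E := PBond (F.P K) 0 → Matrix (Fin 2) (Fin 2) ℂ) (F.P K).L hL2 hG j (pull (bgUnits F K W) (basePt F n K)) hU₀ hα hα3 hα4 h52j B hBa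
    le_rfl hB0 hsmall0 hc₃0 z κ
  have hev : (fun A : PBond (F.P K) 0 → Matrix (Fin 2) (Fin 2) ℂ => avgQG (F.P K).L (pull (bgUnits F K W) (basePt F n K)) (B A) j z κ)
      =ᶠ[𝓝 0] fun A => ((avgIter (F.P K).L (pull (fun b => expUnit (A b)) (basePt F n K) * pull (bgUnits F K W) (basePt F n K)) j z κ : (Matrix (Fin 2) (Fin 2) ℂ)ˣ) :
        Matrix (Fin 2) (Fin 2) ℂ) := by
    filter_upwards [eventually_window F (d := (F.P K).d) (L := (F.P K).L) (k := j) hL1 hexp] with A hA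
    rw [pull_expUnit_eq_expCfg]
    exact (avgIter_eq_avgQG (F.P K).L hL2 hG j (pull (bgUnits F K W) (basePt F n K)) hU₀ hα hα3 hα4 h52j (B A) (norm_nonneg A)
      (fun z κ => norm_pullExp_le F A (basePt F n K) z κ) hA.1 hA.2 z κ).symm
  exact han.congr hev

/-- ★★ **`hT` DISCHARGED — PRINT's SINGLE-BAR COMB TOWER `A ↦ Ũ₁ʲ[(e^{A})♯](z, κ) = \overline{(e^{A})♯U₀♯}ʲ·(Ū₀♯ʲ)⁻¹(z, κ)` IS ANALYTIC AT `A = 0`** for every `j ≤ K − n`, every `z`, `κ`.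
[cite: Balaban1985Averaging, (69) p.29, Proposition 6 p.43] -/
theorem analyticAt_coe_tildIter_of_regPr {ε₀ : ℝ} (hε₀ : 0 < ε₀) (hε : 10 ^ 7 * (F.L : ℝ) ^ 3 * ε₀ ≤ 1)
    (W : GaugeField (F.P K) 0 (Matrix.specialUnitaryGroup (Fin 2) ℂ)) (hreg : RegPr F n K ε₀ W) {j : ℕ} (hj : j ≤ K - n) (z : LSite (F.P K).d) (κ : Fin (F.P K).d) :
    AnalyticAt ℂ (fun A : PBond (F.P K) 0 → Matrix (Fin 2) (Fin 2) ℂ =>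
      ((tildIter (F.P K).L (pull (bgUnits F K W) (basePt F n K)) (pull (fun b => expUnit (A b)) (basePt F n K)) j z κ : (Matrix (Fin 2) (Fin 2) ℂ)ˣ) : Matrix (Fin 2) (Fin 2) ℂ)) 0 := by
  have h := (analyticAt_coe_avgIter_mul_of_regPr hε₀ hε W hreg hj z κ).fun_mul
    (analyticAt_const (v := (((avgIter (F.P K).L (pull (bgUnits F K W) (basePt F n K)) j z κ)⁻¹ : (Matrix (Fin 2) (Fin 2) ℂ)ˣ) : Matrix (Fin 2) (Fin 2) ℂ)))
  refine h.congr (Filter.Eventually.of_forall fun A => ?_)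
  simp only [tildIter_apply, Units.val_mul]

/-- `hT` in `DifferentiableAt` currency (the row of ✓`Prop7CombFrameLinearResponseStep.fderiv_coe_vcov_succ_apply` ∕ ✓`Prop7CombTreeRatioLinearResponse.fderiv_combTreeRatio_apply`).
[cite: Balaban1985Averaging, (69) p.29, Proposition 6 p.43] -/
theorem differentiableAt_coe_tildIter_of_regPr {ε₀ : ℝ} (hε₀ : 0 < ε₀) (hε : 10 ^ 7 * (F.L : ℝ) ^ 3 * ε₀ ≤ 1)
    (W : GaugeField (F.P K) 0 (Matrix.specialUnitaryGroup (Fin 2) ℂ)) (hreg : RegPr F n K ε₀ W) {j : ℕ} (hj : j ≤ K - n) (z : LSite (F.P K).d) (κ : Fin (F.P K).d) :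
    DifferentiableAt ℂ (fun A : PBond (F.P K) 0 → Matrix (Fin 2) (Fin 2) ℂ =>
      ((tildIter (F.P K).L (pull (bgUnits F K W) (basePt F n K)) (pull (fun b => expUnit (A b)) (basePt F n K)) j z κ : (Matrix (Fin 2) (Fin 2) ℂ)ˣ) : Matrix (Fin 2) (Fin 2) ℂ)) 0 :=
  (analyticAt_coe_tildIter_of_regPr hε₀ hε W hreg hj z κ).differentiableAt

/-! ## §3 ★★★ The comb derivative recursion at the member, hypothesis-free -/

/-- ★★★ **THE COMB `ℓ`-RECURSION FOR `ℓ := fderiv … 0 A`, AT THE MEMBER, WITH `hT`∕`hF` DISCHARGED** (`RegPr F n K ε₀ W`, `10⁷L³ε₀ ≤ 1`, `j + 1 ≤ K − n`; letters of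
✓`Prop7CombFrameLinearResponseStep.fderiv_coe_vcov_succ_apply` VERBATIM, family `A ↦ pull (e^{A}) x₀` through `1` by ✓`comb_family_zero`). [cite: Balaban1985Averaging, (97) p.32, (85) p.31, (58) p.27] -/
theorem fderiv_vcov_succ_apply_of_regPr {ε₀ : ℝ} (hε₀ : 0 < ε₀) (hε : 10 ^ 7 * (F.L : ℝ) ^ 3 * ε₀ ≤ 1)
    (W : GaugeField (F.P K) 0 (Matrix.specialUnitaryGroup (Fin 2) ℂ)) (hreg : RegPr F n K ε₀ W) {j : ℕ} (hj : j + 1 ≤ K - n) (z : LSite (F.P K).d)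
    (A : PBond (F.P K) 0 → Matrix (Fin 2) (Fin 2) ℂ) :
    fderiv ℂ (fun t : PBond (F.P K) 0 → Matrix (Fin 2) (Fin 2) ℂ =>
        ((vcov (F.P K).L (pull (bgUnits F K W) (basePt F n K)) (pull (fun b => expUnit (t b)) (basePt F n K)) (j + 1) z : (Matrix (Fin 2) (Fin 2) ℂ)ˣ) : Matrix (Fin 2) (Fin 2) ℂ)) 0 A
      = (Fintype.card (Fin (F.P K).d → Fin (F.P K).L) : ℂ)⁻¹ • ∑ r : Fin (F.P K).d → Fin (F.P K).L,
        (fderiv ℂ (fun t : PBond (F.P K) 0 → Matrix (Fin 2) (Fin 2) ℂ =>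
            ((B7Eq92Concrete.tHol (avgIter (F.P K).L (pull (bgUnits F K W) (basePt F n K)) j)
              (tildIter (F.P K).L (pull (bgUnits F K W) (basePt F n K)) (pull (fun b => expUnit (t b)) (basePt F n K)) j)
              (((F.P K).L : ℤ) • z) (treeWord (boxVec (F.P K).L r)) : (Matrix (Fin 2) (Fin 2) ℂ)ˣ) : Matrix (Fin 2) (Fin 2) ℂ)) 0 A
          + ((hol (avgIter (F.P K).L (pull (bgUnits F K W) (basePt F n K)) j) (((F.P K).L : ℤ) • z) (treeWord (boxVec (F.P K).L r)) : (Matrix (Fin 2) (Fin 2) ℂ)ˣ) :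
              Matrix (Fin 2) (Fin 2) ℂ)
            * fderiv ℂ (fun t : PBond (F.P K) 0 → Matrix (Fin 2) (Fin 2) ℂ =>
                ((vcov (F.P K).L (pull (bgUnits F K W) (basePt F n K)) (pull (fun b => expUnit (t b)) (basePt F n K)) j (((F.P K).L : ℤ) • z + boxVec (F.P K).L r) :
                  (Matrix (Fin 2) (Fin 2) ℂ)ˣ) : Matrix (Fin 2) (Fin 2) ℂ)) 0 A
            * (((hol (avgIter (F.P K).L (pull (bgUnits F K W) (basePt F n K)) j) (((F.P K).L : ℤ) • z) (treeWord (boxVec (F.P K).L r)))⁻¹ : (Matrix (Fin 2) (Fin 2) ℂ)ˣ) :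
              Matrix (Fin 2) (Fin 2) ℂ)) :=
  fderiv_coe_vcov_succ_apply (F.P K).L (pull (bgUnits F K W) (basePt F n K)) (fun t : PBond (F.P K) 0 → Matrix (Fin 2) (Fin 2) ℂ => pull (fun b => expUnit (t b)) (basePt F n K))
    (F.P K).L_pos (comb_family_zero F (n := n) (K := K)) j (fun x κ => differentiableAt_coe_tildIter_of_regPr hε₀ hε W hreg (Nat.le_of_succ_le hj) x κ)
    (fun x => differentiableAt_coe_vcov_of_regPr hε₀ hε W hreg (Nat.le_of_succ_le hj) x) z A

/-! ## §4 ★★★ With FILE 3ᶜ: the tree-ratio summand is `tsum`, and ★px17's `hℓ` row is inhabited by the derivatives -/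

/-- ★★★ **THE COMB TREE-RATIO DERIVATIVE AT THE MEMBER IS `tsum` OF THE SINGLE-BAR DERIVATIVES** (✓`Prop7CombTreeRatioLinearResponse.fderiv_combTreeRatio_apply` with §2's `hT`): every `j ≤ K − n`,
every base `y ∈ ℤ³`, every contour `Γ`, every direction `A`. [cite: Balaban1985Averaging, (58) p.27, (111) p.34] -/
theorem fderiv_combTreeRatio_apply_of_regPr {ε₀ : ℝ} (hε₀ : 0 < ε₀) (hε : 10 ^ 7 * (F.L : ℝ) ^ 3 * ε₀ ≤ 1)
    (W : GaugeField (F.P K) 0 (Matrix.specialUnitaryGroup (Fin 2) ℂ)) (hreg : RegPr F n K ε₀ W) {j : ℕ} (hj : j ≤ K - n) (y : LSite (F.P K).d) (w : List (Letter (F.P K).d))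
    (A : PBond (F.P K) 0 → Matrix (Fin 2) (Fin 2) ℂ) :
    fderiv ℂ (fun t : PBond (F.P K) 0 → Matrix (Fin 2) (Fin 2) ℂ =>
        ((B7Eq92Concrete.tHol (avgIter (F.P K).L (pull (bgUnits F K W) (basePt F n K)) j)
          (tildIter (F.P K).L (pull (bgUnits F K W) (basePt F n K)) (pull (fun b => expUnit (t b)) (basePt F n K)) j) y w : (Matrix (Fin 2) (Fin 2) ℂ)ˣ) : Matrix (Fin 2) (Fin 2) ℂ)) 0 A
      = tsum (avgIter (F.P K).L (pull (bgUnits F K W) (basePt F n K)) j)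
          (fun x κ => fderiv ℂ (fun t : PBond (F.P K) 0 → Matrix (Fin 2) (Fin 2) ℂ =>
            ((tildIter (F.P K).L (pull (bgUnits F K W) (basePt F n K)) (pull (fun b => expUnit (t b)) (basePt F n K)) j x κ : (Matrix (Fin 2) (Fin 2) ℂ)ˣ) : Matrix (Fin 2) (Fin 2) ℂ)) 0 A) y w :=
  (fderiv_combTreeRatio_apply (F.P K).L (pull (bgUnits F K W) (basePt F n K)) (fun t : PBond (F.P K) 0 → Matrix (Fin 2) (Fin 2) ℂ => pull (fun b => expUnit (t b)) (basePt F n K))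
    (comb_family_zero F (n := n) (K := K)) j (fun x κ => differentiableAt_coe_tildIter_of_regPr hε₀ hε W hreg hj x κ) y w A).2

/-- ★★★ **★px17 g4's F-γᶜ2 ROW `hℓ`, INHABITED BY THE DERIVATIVES** (§3 ∘ `fderiv_combTreeRatio_apply_of_regPr`): for `RegPr F n K ε₀ W`, `10⁷L³ε₀ ≤ 1`, `j + 1 ≤ K − n`, every `z ∈ ℤ³` and direction `A`,
`fderiv ℂ (t ↦ ↑(v_{j+1}(t)(z))) 0 A = (Lᵈ)⁻¹ • Σ_r ( tsum Ū₀♯ʲ ℓY (L•z) (treeWord (boxVec L r)) + Ū₀♯ʲ(Γ_r) · fderiv ℂ (t ↦ ↑(v_j(t)(L•z + r))) 0 A · Ū₀♯ʲ(Γ_r)⁻¹ )`,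
`ℓY x κ := fderiv ℂ (t ↦ ↑(Ũ₁ʲ(t)(x, κ))) 0 A` — `Prop7CombFrameRem2RecursionT3.combFrameRem2_recursion_of_regPr`'s `hℓ` at `ℓ := fderiv`, `covTsum = tsum`.
[cite: Balaban1985Averaging, (97) p.32, (85) p.31, (58) p.27, (111) p.34] -/
theorem fderiv_vcov_succ_apply_tsum_of_regPr {ε₀ : ℝ} (hε₀ : 0 < ε₀) (hε : 10 ^ 7 * (F.L : ℝ) ^ 3 * ε₀ ≤ 1)
    (W : GaugeField (F.P K) 0 (Matrix.specialUnitaryGroup (Fin 2) ℂ)) (hreg : RegPr F n K ε₀ W) {j : ℕ} (hj : j + 1 ≤ K - n) (z : LSite (F.P K).d)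
    (A : PBond (F.P K) 0 → Matrix (Fin 2) (Fin 2) ℂ) :
    fderiv ℂ (fun t : PBond (F.P K) 0 → Matrix (Fin 2) (Fin 2) ℂ =>
        ((vcov (F.P K).L (pull (bgUnits F K W) (basePt F n K)) (pull (fun b => expUnit (t b)) (basePt F n K)) (j + 1) z : (Matrix (Fin 2) (Fin 2) ℂ)ˣ) : Matrix (Fin 2) (Fin 2) ℂ)) 0 A
      = (Fintype.card (Fin (F.P K).d → Fin (F.P K).L) : ℂ)⁻¹ • ∑ r : Fin (F.P K).d → Fin (F.P K).L,
        (tsum (avgIter (F.P K).L (pull (bgUnits F K W) (basePt F n K)) j)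
            (fun x κ => fderiv ℂ (fun t : PBond (F.P K) 0 → Matrix (Fin 2) (Fin 2) ℂ =>
              ((tildIter (F.P K).L (pull (bgUnits F K W) (basePt F n K)) (pull (fun b => expUnit (t b)) (basePt F n K)) j x κ : (Matrix (Fin 2) (Fin 2) ℂ)ˣ) : Matrix (Fin 2) (Fin 2) ℂ)) 0 A)
            (((F.P K).L : ℤ) • z) (treeWord (boxVec (F.P K).L r))
          + ((hol (avgIter (F.P K).L (pull (bgUnits F K W) (basePt F n K)) j) (((F.P K).L : ℤ) • z) (treeWord (boxVec (F.P K).L r)) : (Matrix (Fin 2) (Fin 2) ℂ)ˣ) :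
              Matrix (Fin 2) (Fin 2) ℂ)
            * fderiv ℂ (fun t : PBond (F.P K) 0 → Matrix (Fin 2) (Fin 2) ℂ =>
                ((vcov (F.P K).L (pull (bgUnits F K W) (basePt F n K)) (pull (fun b => expUnit (t b)) (basePt F n K)) j (((F.P K).L : ℤ) • z + boxVec (F.P K).L r) :
                  (Matrix (Fin 2) (Fin 2) ℂ)ˣ) : Matrix (Fin 2) (Fin 2) ℂ)) 0 A
            * (((hol (avgIter (F.P K).L (pull (bgUnits F K W) (basePt F n K)) j) (((F.P K).L : ℤ) • z) (treeWord (boxVec (F.P K).L r)))⁻¹ : (Matrix (Fin 2) (Fin 2) ℂ)ˣ) :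
              Matrix (Fin 2) (Fin 2) ℂ)) := by
  rw [fderiv_vcov_succ_apply_of_regPr hε₀ hε W hreg hj z A]
  refine congrArg _ (Finset.sum_congr rfl fun r _ => ?_)
  rw [fderiv_combTreeRatio_apply_of_regPr hε₀ hε W hreg (Nat.le_of_succ_le hj)]

end Summit.QuantumFields.YangMills.Theorems.Prop7CombFrameLinearResponseOfRegPr

end
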